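import Summits.CriticalPhenomena.PercolationContinuityZ3.Theorems.Transplant.SiteCSHDefs
import Summits.CriticalPhenomena.PercolationContinuityZ3.Theorems.PercNearOneGluingNoHeavyLowerTailCSHPeel
import HarnessLib

/-!
# SITE percolation: (S5D)_site peeling — tools (site twin of `Theorems/PercNearOneGluingNoHeavyLowerTailCSHPeelTools.lean`)
# (lane `prim-bschramm`, class C1a)

builds on p205010 (kernel theorem, internal audit signed; external expert review pending).

Site versions of the four tools of the (S5D) peeling (memo PROOF-S5-ALL-R §4, Lemmas P, κ, AC): the top-relay split of
the site ranked surplus (`surplus_erase_add`), the `κ`-bound (`kappa_le_surplus`), the identification of the top-relay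
term with the site conditional covariance `covD` (`covD_eq` — in the site model the surplus functional and the CSH
functional read the SAME object, the site cluster, so BHK's `F̂` disappears), and the `Ψ_iso = 1{C ≠ ∅} = 1{k open}`
identity (`covD_psiIso`).  The level-form algebra (`CSH.cshMarg_congr`, …) is the bond file's, model-free.
Support file (`--supports stmt-CriticalPhenomena-4575 --as helper`); sorry-free.
[cite: KozmaNitzan2024, Conj. 4 (p. 32)] [cite: VandenbergHaggstromKahn2005, Thm. 1.3 (p. 6)]
-/

noncomputable section

namespace Summit.CriticalPhenomena.PercolationContinuityZ3.Theorems.Transplant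

namespace SiteCSH

open MeasureTheory Set Literature.Probability.LatticeModels Literature.Probability.Percolation
open Summit.CriticalPhenomena.PercolationContinuityZ3.Theorems.CSH (slForm cshMarg)
open Summit.CriticalPhenomena.PercolationContinuityZ3.Theorems.SiteTransplant (siteConn mem_siteConn site_sum_measureReal_firstRank)
open SiteGen (mem_siteConn_iff_mem_siteCluster siteCluster_eq_of_mem siteConn_comm)
open scoped Classical

variable {V : Type*} {Γ : SimpleGraph V}

/-- The decoys of `decoyList Γ q A D` are the members of `D`. [folklore] -/
theorem mem_decoyList (q : V → unitInterval) :
    ∀ (A : Set V) (D : List V) (dc : V × (V → ℝ)), dc ∈ decoyList Γ q A D → dc.1 ∈ D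
  | _, [], dc, h => by simp [decoyList] at h
  | A, d :: D, dc, h => by
    simp only [decoyList, List.mem_cons] at h
    rcases h with rfl | h
    · exact List.mem_cons_self
    · exact List.mem_cons_of_mem _ (mem_decoyList q (insert d A) D dc h)

variable {n : ℕ} {Γ : SimpleGraph (Fin n)}

/-- **LEMMA P (core), site**: peeling the rank-maximal relay `k` of `T`:
`Sur_u(T) = Sur_u(T.erase k) + (∫_{D_k ∩ {k↔u}} F(C_k) − P(D_k ∩ {k↔u})·m_k)`, `D_k = {k ↮ T.erase k}`.
[cite: KozmaNitzan2024, Conj. 4 (p. 32)] -/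
theorem surplus_erase_add (q : Fin n → unitInterval) (T : Finset (Fin n)) (r : Fin n → ℕ) (F : Set (Fin n) → ℝ)
    {k : Fin n} (hkT : k ∈ T) (hlt : ∀ a ∈ T.erase k, r a < r k) (u : Fin n) :
    surplus Γ q T r F u = surplus Γ q (T.erase k) r F u +
      ((∫ ω in {ω : Set (Fin n) | ∀ a ∈ (↑(T.erase k) : Set (Fin n)), a ∉ siteCluster Γ ω k} ∩ siteConn Γ k u,
          F (siteCluster Γ ω k) ∂(prodBernoulli q)) -
        (prodBernoulli q).real ({ω : Set (Fin n) | ∀ a ∈ (↑(T.erase k) : Set (Fin n)), a ∉ siteCluster Γ ω k} ∩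
          siteConn Γ k u) * ∫ ω, F (siteCluster Γ ω k) ∂(prodBernoulli q)) := by
  set μ := prodBernoulli q with hμ
  set T' := T.erase k with hT'
  have hmeas : ∀ S : Set (Set (Fin n)), MeasurableSet S := fun _ => MeasurableSet.of_discrete
  have hint : ∀ (g : Set (Fin n) → ℝ) (S : Set (Set (Fin n))), IntegrableOn g S μ :=
    fun g S => (Integrable.of_finite).integrableOn
  set f₀ : Set (Fin n) → ℝ := fun ω => F (siteCluster Γ ω u) with hf₀
  set fk : Set (Fin n) → ℝ := fun ω => F (siteCluster Γ ω k) with hfk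
  set UT : Set (Set (Fin n)) := ⋃ a ∈ T', siteConn Γ u a with hUT
  set Ok : Set (Set (Fin n)) := siteConn Γ u k with hOk
  set Dk : Set (Set (Fin n)) := {ω : Set (Fin n) | ∀ a ∈ (↑T' : Set (Fin n)), a ∉ siteCluster Γ ω k} with hDk
  have hclus : ∀ ω ∈ Ok, siteCluster Γ ω u = siteCluster Γ ω k := fun ω hω =>
    siteCluster_eq_of_mem Γ ((mem_siteConn_iff_mem_siteCluster Γ u k ω).1 hω)
  have hOk' : Ok = siteConn Γ k u := by rw [hOk, siteConn_comm]
  have hfiltT : ∀ a ∈ T', T.filter (fun a' => r a' < r a) = T'.filter (fun a' => r a' < r a) := by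
    intro a ha
    rw [hT', AGloc.filter_erase_of_not]
    exact fun h => lt_asymm h (hlt a ha)
  have hfiltk : T.filter (fun a' => r a' < r k) = T' := by
    ext a
    simp only [Finset.mem_filter, hT', Finset.mem_erase]
    constructor
    · rintro ⟨ha, h⟩; exact ⟨fun hak => lt_irrefl _ (hak ▸ h), ha⟩
    · rintro ⟨hak, ha⟩; exact ⟨ha, hlt a (Finset.mem_erase.2 ⟨hak, ha⟩)⟩
  have hPk : (siteConn Γ u k ∩ ⋂ a' ∈ T.filter (fun a' => r a' < r k), (siteConn Γ u a')ᶜ : Set (Set (Fin n))) =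
      Dk ∩ siteConn Γ k u := by
    rw [hfiltk, ← hOk']
    ext ω
    simp only [hDk, hOk, mem_inter_iff, mem_iInter, mem_compl_iff, mem_setOf_eq, Finset.mem_coe]
    constructor
    · rintro ⟨hk', h⟩
      refine ⟨fun a ha hka => h a ha ?_, hk'⟩
      rw [mem_siteConn_iff_mem_siteCluster, hclus ω hk']; exact hka
    · rintro ⟨h, hk'⟩
      refine ⟨hk', fun a ha hoa => h a ha ?_⟩
      rw [← hclus ω hk']; exact (mem_siteConn_iff_mem_siteCluster Γ u a ω).1 hoa
  have hsumT : ∑ a ∈ T, μ.real (siteConn Γ u a ∩ ⋂ a' ∈ T.filter (fun a' => r a' < r a), (siteConn Γ u a')ᶜ : Set (Set (Fin n))) *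
        ∫ ω, F (siteCluster Γ ω a) ∂μ =
      ∑ a ∈ T', μ.real (siteConn Γ u a ∩ ⋂ a' ∈ T'.filter (fun a' => r a' < r a), (siteConn Γ u a')ᶜ : Set (Set (Fin n))) *
        ∫ ω, F (siteCluster Γ ω a) ∂μ + μ.real (Dk ∩ siteConn Γ k u) * ∫ ω, fk ω ∂μ := by
    rw [← Finset.add_sum_erase T _ hkT, hPk, add_comm]
    congr 1
    refine Finset.sum_congr rfl fun a ha => ?_
    rw [hfiltT a ha]
  have hUA : (⋃ a ∈ T, (siteConn Γ u a : Set (Set (Fin n)))) = UT ∪ Ok := by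
    ext ω
    simp only [hUT, hOk, mem_iUnion, mem_union, exists_prop, hT', Finset.mem_erase]
    constructor
    · rintro ⟨a, ha, h⟩
      by_cases hak : a = k
      · exact Or.inr (hak ▸ h)
      · exact Or.inl ⟨a, ⟨hak, ha⟩, h⟩
    · rintro (⟨a, ⟨_, ha⟩, h⟩ | h)
      · exact ⟨a, ha, h⟩
      · exact ⟨k, hkT, h⟩
  have h0k : ∀ ω ∈ Dk ∩ siteConn Γ k u, f₀ ω = fk ω := fun ω hω => by
    simp only [hf₀, hfk]
    have : ω ∈ Ok := by rw [hOk']; exact hω.2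
    rw [hclus ω this]
  have hdiff : (UT ∪ Ok) \ UT = Dk ∩ siteConn Γ k u := by
    rw [← hOk']
    ext ω
    simp only [hUT, hOk, hDk, mem_sdiff, mem_union, mem_iUnion, mem_inter_iff, exists_prop, not_exists, not_and,
      mem_setOf_eq, Finset.mem_coe]
    constructor
    · rintro ⟨h | h, hno⟩
      · obtain ⟨a, ha, h'⟩ := h; exact absurd h' (hno a ha)
      · refine ⟨fun a ha hka => hno a ha ?_, h⟩
        rw [mem_siteConn_iff_mem_siteCluster, hclus ω h]; exact hka
    · rintro ⟨hd, hk'⟩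
      refine ⟨Or.inr hk', fun a ha hoa => hd a ha ?_⟩
      rw [← hclus ω hk']; exact (mem_siteConn_iff_mem_siteCluster Γ u a ω).1 hoa
  have hsplit : ∫ ω in UT ∪ Ok, f₀ ω ∂μ = ∫ ω in UT, f₀ ω ∂μ + ∫ ω in Dk ∩ siteConn Γ k u, fk ω ∂μ := by
    rw [← integral_inter_add_sdiff (hmeas UT) (hint f₀ (UT ∪ Ok)), inter_eq_right.2 subset_union_left, hdiff,
      setIntegral_congr_fun (hmeas _) fun ω hω => h0k ω hω]
  unfold surplus
  rw [hsumT, hUA, hsplit]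
  ring

/-- **LEMMA κ, site**: with `D_k = {k ↮ T'}` and `m_k` maximal on `T' ∪ {k}`, the deficit
`κ_k = m_k·P(D_k) − ∫_{D_k} F(C_k)` is at most `Sur_k(T')`. [cite: KozmaNitzan2024, Conj. 4 (p. 32)] -/
theorem kappa_le_surplus (q : Fin n → unitInterval) (T' : Finset (Fin n)) (r : Fin n → ℕ) (F : Set (Fin n) → ℝ)
    (k : Fin n) (hrT : Set.InjOn r ↑T')
    (hmle : ∀ a ∈ T', ∫ ω, F (siteCluster Γ ω a) ∂(prodBernoulli q) ≤ ∫ ω, F (siteCluster Γ ω k) ∂(prodBernoulli q)) :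
    (∫ ω, F (siteCluster Γ ω k) ∂(prodBernoulli q)) *
        (prodBernoulli q).real {ω : Set (Fin n) | ∀ a ∈ (↑T' : Set (Fin n)), a ∉ siteCluster Γ ω k} -
      ∫ ω in {ω : Set (Fin n) | ∀ a ∈ (↑T' : Set (Fin n)), a ∉ siteCluster Γ ω k}, F (siteCluster Γ ω k) ∂(prodBernoulli q) ≤
      surplus Γ q T' r F k := by
  set μ := prodBernoulli q with hμ
  have hmeas : ∀ S : Set (Set (Fin n)), MeasurableSet S := fun _ => MeasurableSet.of_discrete
  have hn := fun (S : Set (Set (Fin n))) => (measureReal_nonneg : 0 ≤ μ.real S)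
  set fk : Set (Fin n) → ℝ := fun ω => F (siteCluster Γ ω k) with hfk
  set mk : ℝ := ∫ ω, fk ω ∂μ with hmk
  set Dk : Set (Set (Fin n)) := {ω : Set (Fin n) | ∀ a ∈ (↑T' : Set (Fin n)), a ∉ siteCluster Γ ω k} with hDk
  set Wk : Set (Set (Fin n)) := ⋃ a ∈ T', siteConn Γ k a with hWk
  have hDW : Dk = Wkᶜ := by
    ext ω
    simp only [hDk, hWk, mem_setOf_eq, mem_compl_iff, mem_iUnion, exists_prop, not_exists, not_and, Finset.mem_coe]
    constructor
    · intro h a ha hka; exact h a ha ((mem_siteConn_iff_mem_siteCluster Γ k a ω).1 hka)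
    · intro h a ha hka; exact h a ha ((mem_siteConn_iff_mem_siteCluster Γ k a ω).2 hka)
  have hDint : ∫ ω in Dk, fk ω ∂μ = mk - ∫ ω in Wk, fk ω ∂μ := by
    have := integral_add_compl (hmeas Wk) (Integrable.of_finite (f := fk) (μ := μ))
    rw [← hDW] at this
    linarith
  have hDμ : μ.real Dk = 1 - μ.real Wk := by
    have h1 : μ.real (univ : Set (Set (Fin n))) = μ.real (univ ∩ Wk) + μ.real (univ \ Wk) :=
      (measureReal_inter_add_sdiff (s := univ) (h := measure_ne_top _ _) (hmeas Wk)).symm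
    rw [probReal_univ, univ_inter, ← compl_eq_univ_sdiff, ← hDW] at h1
    linarith
  have hWsum : ∑ a ∈ T', μ.real (siteConn Γ k a ∩ ⋂ a' ∈ T'.filter (fun a' => r a' < r a), (siteConn Γ k a')ᶜ : Set (Set (Fin n))) =
      μ.real Wk := site_sum_measureReal_firstRank Γ q T' r k hrT
  have hsum : ∑ a ∈ T', μ.real (siteConn Γ k a ∩ ⋂ a' ∈ T'.filter (fun a' => r a' < r a), (siteConn Γ k a')ᶜ : Set (Set (Fin n))) *
        ∫ ω, F (siteCluster Γ ω a) ∂μ ≤ mk * μ.real Wk := by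
    have : ∑ a ∈ T', μ.real (siteConn Γ k a ∩ ⋂ a' ∈ T'.filter (fun a' => r a' < r a), (siteConn Γ k a')ᶜ : Set (Set (Fin n))) *
        ∫ ω, F (siteCluster Γ ω a) ∂μ ≤
        ∑ a ∈ T', μ.real (siteConn Γ k a ∩ ⋂ a' ∈ T'.filter (fun a' => r a' < r a), (siteConn Γ k a')ᶜ : Set (Set (Fin n))) * mk :=
      Finset.sum_le_sum fun a ha => mul_le_mul_of_nonneg_left (hmle a ha) (hn _)
    rw [← Finset.sum_mul, hWsum] at this
    linarith
  unfold surplus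
  rw [hDint, hDμ]
  change mk * (1 - μ.real Wk) - (mk - ∫ ω in Wk, fk ω ∂μ) ≤ (∫ ω in Wk, fk ω ∂μ) - _
  linarith

/-- **The top-relay term against `covD`, site** (no `F̂`: the site surplus and the site CSH read the same cluster):
`P(D_k)·(∫_{D_k∩{k↔u}} F(C_k) − P(D_k∩{k↔u}) m_k) = covD(k; T'; F)(u) − κ_k·P(D_k ∩ {k↔u})`. [folklore] -/
theorem covD_eq (q : Fin n → unitInterval) (T' : Finset (Fin n)) (F : Set (Fin n) → ℝ) (k u : Fin n) :
    (prodBernoulli q).real {ω : Set (Fin n) | ∀ a ∈ (↑T' : Set (Fin n)), a ∉ siteCluster Γ ω k} *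
        ((∫ ω in {ω : Set (Fin n) | ∀ a ∈ (↑T' : Set (Fin n)), a ∉ siteCluster Γ ω k} ∩ siteConn Γ k u,
            F (siteCluster Γ ω k) ∂(prodBernoulli q)) -
          (prodBernoulli q).real ({ω : Set (Fin n) | ∀ a ∈ (↑T' : Set (Fin n)), a ∉ siteCluster Γ ω k} ∩
            siteConn Γ k u) * ∫ ω, F (siteCluster Γ ω k) ∂(prodBernoulli q)) =
      covD Γ q k (↑T' : Set (Fin n)) F u -
        ((∫ ω, F (siteCluster Γ ω k) ∂(prodBernoulli q)) *
            (prodBernoulli q).real {ω : Set (Fin n) | ∀ a ∈ (↑T' : Set (Fin n)), a ∉ siteCluster Γ ω k} -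
          ∫ ω in {ω : Set (Fin n) | ∀ a ∈ (↑T' : Set (Fin n)), a ∉ siteCluster Γ ω k},
            F (siteCluster Γ ω k) ∂(prodBernoulli q)) *
        (prodBernoulli q).real ({ω : Set (Fin n) | ∀ a ∈ (↑T' : Set (Fin n)), a ∉ siteCluster Γ ω k} ∩
          siteConn Γ k u) := by
  unfold covD
  simp only [Finset.mem_coe]
  ring

/-- The site "not isolated" functional `Ψ_iso(C) = 1{C ≠ ∅}` (for the site cluster of `k`: `1{k open}`). [folklore] -/
def psiIsoSite : Set V → ℝ := fun C => if C = ∅ then 0 else 1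

/-- `Ψ_iso` is monotone. [folklore] -/
theorem psiIso_mono : Monotone (psiIsoSite (V := V)) := by
  intro C C' h
  unfold psiIsoSite
  by_cases hC : C = ∅
  · rw [if_pos hC]; split_ifs <;> norm_num
  · have hC' : C' ≠ ∅ := fun h' => hC (subset_empty_iff.1 (h' ▸ h))
    rw [if_neg hC, if_neg hC']

/-- On `{k ↔ u}` the site cluster of `k` is nonempty, so `Ψ_iso(C_k) = 1`. [folklore] -/
theorem psiIso_eq_one_of_mem {ω : Set (Fin n)} {k u : Fin n} (h : ω ∈ siteConn Γ k u) :
    psiIsoSite (siteCluster Γ ω k) = 1 := by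
  unfold psiIsoSite
  rw [if_neg]
  exact fun h0 => by
    have hu : u ∈ siteCluster Γ ω k := (mem_siteConn_iff_mem_siteCluster Γ k u ω).1 h
    rw [h0] at hu; exact hu

/-- **The `Ψ_iso` identity behind LEMMA AC, site**: `covD(k; T'; Ψ_iso)(u) = P(D_k ∩ {C_k = ∅}) · P(D_k ∩ {k↔u})`.
[folklore] -/
theorem covD_psiIso (q : Fin n → unitInterval) (T' : Finset (Fin n)) (k u : Fin n) :
    covD Γ q k (↑T' : Set (Fin n)) psiIsoSite u =
      (prodBernoulli q).real ({ω : Set (Fin n) | ∀ a ∈ (↑T' : Set (Fin n)), a ∉ siteCluster Γ ω k} ∩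
          {ω | siteCluster Γ ω k = ∅}) *
        (prodBernoulli q).real ({ω : Set (Fin n) | ∀ a ∈ (↑T' : Set (Fin n)), a ∉ siteCluster Γ ω k} ∩
          siteConn Γ k u) := by
  set μ := prodBernoulli q with hμ
  have hmeas : ∀ S : Set (Set (Fin n)), MeasurableSet S := fun _ => MeasurableSet.of_discrete
  set Dk : Set (Set (Fin n)) := {ω : Set (Fin n) | ∀ a ∈ (↑T' : Set (Fin n)), a ∉ siteCluster Γ ω k} with hDk
  have h1 : ∫ ω in Dk ∩ siteConn Γ k u, psiIsoSite (siteCluster Γ ω k) ∂μ = μ.real (Dk ∩ siteConn Γ k u) := by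
    rw [setIntegral_congr_fun (hmeas _) (fun ω hω => psiIso_eq_one_of_mem hω.2), setIntegral_const, smul_eq_mul,
      mul_one]
  have h2 : ∫ ω in Dk, psiIsoSite (siteCluster Γ ω k) ∂μ = μ.real Dk - μ.real (Dk ∩ {ω | siteCluster Γ ω k = ∅}) := by
    have hsplit := (integral_inter_add_sdiff (hmeas {ω : Set (Fin n) | siteCluster Γ ω k = ∅})
      ((Integrable.of_finite (f := fun ω => psiIsoSite (siteCluster Γ ω k)) (μ := μ)).integrableOn (s := Dk))).symm
    rw [hsplit]
    have ha : ∫ ω in Dk ∩ {ω | siteCluster Γ ω k = ∅}, psiIsoSite (siteCluster Γ ω k) ∂μ = 0 := by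
      rw [setIntegral_congr_fun (hmeas _) (fun ω hω => by
        show psiIsoSite (siteCluster Γ ω k) = (0 : ℝ)
        unfold psiIsoSite; rw [if_pos (show siteCluster Γ ω k = ∅ from hω.2)])]
      simp
    have hb : ∫ ω in Dk \ {ω | siteCluster Γ ω k = ∅}, psiIsoSite (siteCluster Γ ω k) ∂μ =
        μ.real (Dk \ {ω | siteCluster Γ ω k = ∅}) := by
      rw [setIntegral_congr_fun (hmeas _) (fun ω hω => by
        show psiIsoSite (siteCluster Γ ω k) = (1 : ℝ)
        unfold psiIsoSite; rw [if_neg (show ¬ (siteCluster Γ ω k = ∅) from hω.2)]), setIntegral_const, smul_eq_mul, mul_one]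
    rw [ha, hb, zero_add]
    have := measureReal_inter_add_sdiff (μ := μ) (s := Dk) (h := measure_ne_top _ _)
      (hmeas {ω : Set (Fin n) | siteCluster Γ ω k = ∅})
    linarith
  unfold covD
  simp only [Finset.mem_coe] at hDk ⊢
  rw [← hDk, h1, h2]
  ring

end SiteCSH

end Summit.CriticalPhenomena.PercolationContinuityZ3.Theorems.Transplant
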